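import Summits.Ventures.HodgeRepro.Tier4.Line4.L1Class
import Summits.Ventures.HodgeRepro.Tier4.Line4.L1ClassWall

/-!
# Tier4/Line4/L1ClassV3 — §15 v3: the lead's (R-16) ruling (S14891) applied to v2 (Assembly-v33 d979ecf30f9f712a · 666 =
L1Class p699130 + L1ClassWall p699357), as an APPEND (no accepted display edited in place; consumers re-bind)

Two objections, one fix (S14879 crit-1 PRECISION 3; S14886 L2-p3's finding):

* **(3′) `RtfSpectralL1'`** = (3) + `PoincareSummable S f₁` on the FIRST test.  (3) as displayed in v2 is FALSE (L2-p3 g4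
  S14886: toy `ℝ²/ℤ²`, `u ∈ L¹(ℝ/ℤ)` with `|û(n)| ≥ c n^{−1/3}` against the Hardy–Littlewood continuous `v` with
  `|v̂(n)| = n^{−2/3}`: `∑ |û v̂| = ∞`, no `HasSum`); (3′) is what L2-p3 proves (`rtfSpectralL1_of_poincare`, module
  `Tier4/Line4/SpectralL1`).  The vacuous (3) is consumed nowhere below.
* **`archDist` and the decay field.**  `TailForArch` over EVERY `IsArchCoeff` finf is unprovable by the named mechanism
  (crit-1 Entry 102): TAIL's `hdecay` needs the archimedean decay `e^{−3d}` of the weight-3 coefficient, a property of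
  `D3coeff` (`‖D3coeff g‖ = ‖ℓ₀₀ g‖⁻³`, L1-p5 p699431, crit-1 S14905), not of an arbitrary equivariant `L¹`
  pseudo-coefficient.  THE `d`-VOCABULARY, fixed here for D3COEFF (decay), LatticeCount (the sublevel count) and TAIL
  (`hdecay` / `hsparse` / `hcount`) alike: `archSizeAt W w x := ∑ᵢⱼ ‖adToC w (x)ᵢⱼ‖` (the `ℓ¹` size of the `4×4` entries
  of `x` read at the infinite place `w`) and `archDist W x := ∑_w log (max 1 (archSizeAt W w x))` — the SUM over the
  infinite places (not the max): for `finfD3 = D3coeff ⊗ bumps` the bound `‖finf x‖ ≤ C e^{−3 archDist x}` holds because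
  the bumps are compactly supported at the other places (bounded `archSizeAt` there on the support) and at `w₀` every
  `4×4` entry is `≤ c ‖ℓ₀₀‖` (the `U(1,1)` relations of LocalUnitary p699064: `|ℓ₁₁| = |ℓ₀₀|`, `|ℓ₀₁|² = |ℓ₀₀|² − 1`);
  and the sublevel count `#{γ ∈ G(k) ∩ (compact) : archDist γ ≤ T} ≤ C′ e^{βT}` holds with `β = 2 + ε < 3` for ANY number of
  indefinite real places (hyperbolic lattice count `e^{2T}` per `U(1,1)`-place, convolved along the SUM: `T^{r−1} e^{2T}`) —
  with the max instead of the sum the count would be `e^{2rT}` and the Poincaré series of a decay-`3` function would diverge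
  for `r ≥ 2`.  `HasDecay3 W finf := ∃ C, ∀ x, ‖finf x‖ ≤ C · exp (−3 · archDist W x)`; `IsArchCoeffD` = `IsArchCoeff` + `decay`;
  `D3CoeffData'` over it.
* **`PoincareOfDecay W S`** — the display that replaces `PoincareOfConv` for the FIRST test `prodFn finf ffin` (the lead's (c),
  the named theorem `poincareSummable_of_decay` is L4-p2's; its hypothesis, the sublevel count, is L4-p2's own display on the
  seesaw plane): `∀ finf ffin, Continuous finf → HasDecay3 W finf → IsFinFactor W ffin → PoincareSummable S (prodFn W finf ffin)`.
  The wall's (3′)-application then has its `hP₁` from `hPd` and `hfinf.decay`.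
* **`TailForArch'`** — over `IsArchCoeffD` (decaying coefficients only), with `γ₀ : S.Gk` RATIONAL and the orbit fixed to
  `o₀ := S.orbitOf γ₀` (crit-1's RECORD precision (b): with `o₀` free the display is refutable by `o₀ ≠ orbitOf γ₀`).
* **`wall_of_L1_data'`** (proved, sorry-free): v2's `wall_of_L1_data` with `hspec'` (3′), `hPd`, `D3CoeffData'`, `TailForArch'`;
  the proof is v2's with `twoVector_hit_L1'` (the (3′) version of 2VEC-HIT, `hP₁` threaded) in place of `twoVector_hit_L1`.

Nothing here says anything about the status of the Hodge conjecture for CM abelian varieties, which is NOT proved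
(HC_CM is NOT proved by anyone in this repository).
-/

set_option autoImplicit false

noncomputable section
namespace Summit.Ventures.HodgeRepro.Tier4.Line4.L1Class

open MeasureTheory Topology NumberField Summit.Ventures.HodgeRepro.Tier4.Common
  Summit.Ventures.HodgeRepro.Tier4.Line1 Summit.Ventures.HodgeRepro.Tier4.Line1.RTF

open scoped Pointwise

/-! ## Part A′ — (3′): the spectral side with the Poincaré clause on the first test -/

section AbstractV3

variable {G : Type} [Group G] [TopologicalSpace G] [IsTopologicalGroup G] [MeasurableSpace G] [BorelSpace G]
  (S : Setting G)

/-- **(3′) the SPECTRAL side for an `L¹ ∩ C⁰` first test WITH the Poincaré clause** (L2-p3 g4 S14886, the lead's (R-16)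
(b)): for every character pair, every adapted ONB, every `f₁ ∈ L¹ ∩ C⁰` whose kernel series is uniformly bounded on
compacts, and every `f₂ ∈ C_c`, `J(f₁ ⋆ f₂) = ∑_j specTerm_j` (absolutely).  `hP₁` applied to `C₁ = closure D_T`,
`C₂ = closure D_G` is exactly `K_{f₁}(x,·) ∈ L²(D_G)` uniformly in `x` — what Parseval and the Bessel bound need.
(3) without `hP₁` is FALSE (the toy counterexample of S14886) and is displayed nowhere. -/
def RtfSpectralL1' : Prop :=
  ∀ (χ : S.T → ℂ) (χ' : S.T' → ℂ), S.IsCharacter χ → S.IsCharacter' χ' →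
    ∀ (τ : ℕ → Set (G → ℂ)) (φ : ℕ → G → ℂ) (n : ℕ → ℕ), S.IsAdaptedONB τ φ n →
      ∀ f₁ f₂ : G → ℂ, IsTestL1 S f₁ → PoincareSummable S f₁ → IsTest f₂ →
        HasSum (fun j => S.specTerm χ χ' φ f₁ f₂ j) (S.J χ χ' (S.conv f₁ f₂))

/-- **the generic assembly through one number, (3′) version** (proved): `exists_periods_of_J_ne_zero` with the Poincaré
clause of the first test threaded. -/
theorem exists_periods_of_J_ne_zero' (hspec : RtfSpectralL1' S) {χ : S.T → ℂ} {χ' : S.T' → ℂ}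
    (hχ : S.IsCharacter χ) (hχ' : S.IsCharacter' χ') {τ : ℕ → Set (G → ℂ)} {φ : ℕ → G → ℂ} {n : ℕ → ℕ}
    (hB : S.IsAdaptedONB τ φ n) (hcl : AdaptedClosedUnderL1 S τ) {f₁ f₂ : G → ℂ} (h₁ : IsTestL1 S f₁)
    (hP₁ : PoincareSummable S f₁) (h₂ : IsTest f₂) (hJ : S.J χ χ' (S.conv f₁ f₂) ≠ 0) :
    ∃ m, S.PeriodNonzeroT χ (τ m) ∧ S.PeriodNonzeroT' χ' (τ m) ∧ S.Hit (RTF.cj f₁) (τ m) := by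
  obtain ⟨j, hj⟩ := exists_term_ne_zero (hspec χ χ' hχ hχ' τ φ n hB f₁ f₂ h₁ hP₁ h₂) hJ
  exact ⟨n j, atoms_L1 S hB hcl h₁ h₂ j hj⟩

end AbstractV3

/-! ## Part C′ — the `d`-vocabulary, the decay field, the Poincaré display for the product test -/

section ArchV3

variable {k : Type} [Field k] [NumberField k] (W : PlaneData k) [MeasurableSpace (GA W)] [BorelSpace (GA W)]

omit [MeasurableSpace (GA W)] [BorelSpace (GA W)] in
/-- **the archimedean size of `x ∈ G(𝔸)` at the infinite place `w`**: the `ℓ¹` norm of the `4×4` entries of `x` read at `w`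
through `Common.adToC w : 𝔸_k →+* ℂ` (RowWeights p69xxxx). -/
def archSizeAt (w : InfinitePlace k) (x : GA W) : ℝ :=
  ∑ i : Fin 4, ∑ j : Fin 4, ‖Common.adToC w (GA.mat W x i j)‖

omit [MeasurableSpace (GA W)] [BorelSpace (GA W)] in
/-- **the archimedean distance `d(x)`** (the `d`-vocabulary of D3COEFF, LatticeCount and TAIL): the SUM over the infinite
places of `log⁺ (archSizeAt w x)`.  On the `U(1,1)`-place `w₀` this is `log ‖ℓ₀₀(x_{w₀})‖ + O(1)` (the `4×4` real entries are
bounded by `c ‖ℓ₀₀‖`, LocalUnitary), so that `‖D3coeff‖ = ‖ℓ₀₀‖⁻³ ≍ e^{−3 d}`; the lattice count in `{d ≤ T}` grows like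
`e^{(2+ε) T}` (hyperbolic lattice count per indefinite place, convolved along the sum). -/
def archDist (x : GA W) : ℝ :=
  ∑ w : InfinitePlace k, Real.log (max 1 (archSizeAt W w x))

omit [MeasurableSpace (GA W)] [BorelSpace (GA W)] in
/-- `archDist` is non-negative (each summand is `log (max 1 ·) ≥ 0`). -/
theorem archDist_nonneg (x : GA W) : 0 ≤ archDist W x :=
  Finset.sum_nonneg fun _ _ => Real.log_nonneg (le_max_left _ _)

omit [MeasurableSpace (GA W)] [BorelSpace (GA W)] in
/-- **weight-3 decay** with respect to `archDist`: `‖finf x‖ ≤ C e^{−3 d(x)}` (Harish-Chandra: the matrix coefficients of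
the weight-`3` discrete series decay like `e^{−3t}` on `a_t`; lit-5's rows 65–66, the same estimate as `L¹`). -/
def HasDecay3 (finf : GA W → ℂ) : Prop :=
  ∃ C : ℝ, ∀ x : GA W, ‖finf x‖ ≤ C * Real.exp (-(3 * archDist W x))

/-- **(7″) the archimedean coefficient WITH decay** (= v2's `IsArchCoeff` + the field `decay`; the lead's (R-16) (a),
pointwise form). -/
structure IsArchCoeffD (S : RTF.Setting (GA W)) (R : RTFData W) (q : QuadData k) (g g' : Matrix (Fin 4) (Fin 4) k)
    (w₀ : InfinitePlace k) (eP eM eP' eM' : InfinitePlace k → ℤ) (γ₀ : GA W) (νinf : Measure (torusInf W))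
    (νinf' : Measure (torusInf' W)) (finf : GA W → ℂ) : Prop
    extends IsArchCoeff W S R q g g' w₀ eP eM eP' eM' γ₀ νinf νinf' finf where
  decay : HasDecay3 W finf

/-- **C-L4-D3COEFF — the statement, v3**: a decaying archimedean coefficient exists. -/
def D3CoeffData' (S : RTF.Setting (GA W)) (R : RTFData W) (q : QuadData k) (g g' : Matrix (Fin 4) (Fin 4) k)
    (w₀ : InfinitePlace k) (eP eM eP' eM' : InfinitePlace k → ℤ) (γ₀ : GA W) (νinf : Measure (torusInf W))
    (νinf' : Measure (torusInf' W)) : Prop :=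
  ∃ finf : GA W → ℂ, IsArchCoeffD W S R q g g' w₀ eP eM eP' eM' γ₀ νinf νinf' finf

/-- **the Poincaré clause for the PRODUCT first test `finf ⊗ ffin` from decay** (the lead's (R-16) (c): the named theorem
`poincareSummable_of_decay` of L4-p2 g4 proves this display from the sublevel lattice count `#{γ ∈ G(k) ∩ (compact) :
archDist γ ≤ T} ≤ C′ e^{βT}`, `β < 3`, by the layer-cake `summable_exp_of_count` (TailAssembly p698591)). -/
def PoincareOfDecay (S : RTF.Setting (GA W)) : Prop :=
  ∀ finf ffin : GA W → ℂ, Continuous finf → HasDecay3 W finf → IsFinFactor W ffin →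
    PoincareSummable S (prodFn W finf ffin)

end ArchV3

/-! ## Layer A′ — 2VEC-HIT under (3′) -/

section LayerAV3

open scoped ComplexConjugate

variable {k : Type} [Field k] [NumberField k] (W : PlaneData k) [MeasurableSpace (GA W)] [BorelSpace (GA W)]
  (R : RTFData W) (μ : Measure (GA W)) [μ.IsHaarMeasure] [R.μT.IsHaarMeasure] [R.μT'.IsHaarMeasure]
  (DG : Set (GA W)) (fdG : IsFundamentalDomain (rationalPoints W) DG μ) (compG : IsCompact (closure DG))
  (compT : IsCompact (closure R.DT)) (compT' : IsCompact (closure R.DT'))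

/-- **2VEC-HIT for an `L¹` first test, (3′) version** (proved): `twoVector_hit_L1` with `hspec' : RtfSpectralL1'` and the
Poincaré clause `hP₁` of the first test. -/
theorem twoVector_hit_L1' (hc : Continuous R.chi) (hu : ∀ a, ‖R.chi a‖ = 1)
    (hc' : Continuous R.chi') (hunit' : ∀ t, ‖R.chi' t‖ = 1)
    {τ : ℕ → Set (GA W → ℂ)} {φ : ℕ → GA W → ℂ} {n : ℕ → ℕ}
    (hB : (Setting.ofAdelicData W R μ DG fdG compG compT compT').IsAdaptedONB τ φ n)
    (hspec : RtfSpectralL1' (Setting.ofAdelicData W R μ DG fdG compG compT compT'))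
    (hcl : AdaptedClosedUnderL1 (Setting.ofAdelicData W R μ DG fdG compG compT compT') τ)
    {f₁ f₂ : GA W → ℂ} (h₁ : IsTestL1 (Setting.ofAdelicData W R μ DG fdG compG compT compT') f₁)
    (hP₁ : PoincareSummable (Setting.ofAdelicData W R μ DG fdG compG compT compT') f₁)
    (h₂ : IsTestFn W f₂)
    (hJ : (Setting.ofAdelicData W R μ DG fdG compG compT compT').J R.chi R.chi'
      ((Setting.ofAdelicData W R μ DG fdG compG compT compT').conv f₁ f₂) ≠ 0) :
    ∃ j : ℕ, (Setting.ofAdelicData W R μ DG fdG compG compT compT').Hit (RTF.cj f₁) (τ (n j)) ∧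
      periodLin W R.μT' R.DT' R.chi'
        (restrictTo W (torusT' W) fun x => conj (rightRegular W μ (RTF.refl f₂) (φ j) x)) ≠ 0 ∧
      periodLin W R.μT R.DT R.chi
        (restrictTo W (torusT W) fun x => conj (rightRegular W μ (RTF.cj f₁) (φ j) x)) ≠ 0 := by
  set S := Setting.ofAdelicData W R μ DG fdG compG compT compT' with hS
  have h₂' : RTF.IsTest f₂ := ⟨h₂.1, h₂.2⟩
  obtain ⟨j, hterm⟩ := exists_term_ne_zero
    (hspec R.chi R.chi' (isCharacter_chi W R μ DG fdG compG compT compT' hc hu)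
      (isCharacter'_chi' W R μ DG fdG compG compT compT' hc' hunit') τ φ n hB f₁ f₂ h₁ hP₁ h₂') hJ
  have hterm' := hterm
  unfold RTF.Setting.specTerm at hterm'
  have hP' : S.periodT' R.chi' (fun t' => S.R (RTF.refl f₂) (φ j) t') ≠ 0 := left_ne_zero_of_mul hterm'
  have hP : conj (S.periodT R.chi (fun t => S.R (RTF.cj f₁) (φ j) t)) ≠ 0 := right_ne_zero_of_mul hterm'
  have hhit : S.Hit (RTF.cj f₁) (τ (n j)) := (atoms_L1 S hB hcl h₁ h₂' j hterm).2.2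
  have hc₁ : Continuous (S.R (RTF.cj f₁) (φ j)) :=
    (hB.inv (n j)).cont _ (hcl (n j) (φ j) (hB.mem j) _ (h₁.cj S))
  have hc₂ : Continuous (S.R (RTF.refl f₂) (φ j)) :=
    (hB.inv (n j)).cont _ ((hB.inv (n j)).conv (φ j) (hB.mem j) _ h₂'.refl)
  refine ⟨j, hhit, ?_, ?_⟩
  · rw [← R_ofAdelicData_eq W R μ DG fdG compG compT compT',
      periodLin_chi'_conj_eq W R μ DG fdG compG compT compT' hc' hc₂]
    intro h0
    apply hP'
    have := congrArg conj h0
    rw [Complex.conj_conj, map_zero] at this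
    exact this
  · rw [← R_ofAdelicData_eq W R μ DG fdG compG compT compT',
      periodLin_chi_conj_eq W R μ DG fdG compG compT compT' hc hc₁]
    exact hP

end LayerAV3

/-! ## Layer B′ — TAIL over decaying coefficients, the wall from the v3 displays -/

section LayerBV3

open scoped ComplexConjugate

variable {k : Type} [Field k] [NumberField k] (W : PlaneData k) [MeasurableSpace (GA W)] [BorelSpace (GA W)]
  (R : RTFData W) (μ : Measure (GA W)) [μ.IsHaarMeasure] [R.μT.IsHaarMeasure] [R.μT'.IsHaarMeasure]
  (DG : Set (GA W)) (fdG : IsFundamentalDomain (rationalPoints W) DG μ) (compG : IsCompact (closure DG))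
  (compT : IsCompact (closure R.DT)) (compT' : IsCompact (closure R.DT'))

/-- **C-L4-TAIL — the display consumed by the assembly, v3**: for every DECAYING archimedean coefficient at the RATIONAL
`γ₀` there is a level family (`TailFamily`) dominated from some level on by the term of the orbit `S.orbitOf γ₀`
(`LevelTailDominated`), for the characters of `R`.  (`o₀` is no longer free — crit-1's RECORD precision (b).) -/
def TailForArch' (q : QuadData k) (g g' : Matrix (Fin 4) (Fin 4) k) (w₀ : InfinitePlace k)
    (eP eM eP' eM' : InfinitePlace k → ℤ)
    (γ₀ : (Setting.ofAdelicData W R μ DG fdG compG compT compT').Gk)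
    (νinf : Measure (torusInf W)) (νinf' : Measure (torusInf' W)) : Prop :=
  ∀ finf : GA W → ℂ,
    IsArchCoeffD W (Setting.ofAdelicData W R μ DG fdG compG compT compT') R q g g' w₀ eP eM eP' eM' (γ₀ : GA W)
      νinf νinf' finf →
    ∃ ffin f₂ : ℕ → GA W → ℂ, TailFamily W q g g' eP' eM' ffin f₂ ∧
      LevelTailDominated W (Setting.ofAdelicData W R μ DG fdG compG compT compT') R.chi R.chi'
        ((Setting.ofAdelicData W R μ DG fdG compG compT compT').orbitOf γ₀) finf ffin f₂

/-- **THE WALL FROM THE §15 v3 DISPLAYS** (proved, sorry-free): v2's `wall_of_L1_data` with (3′) in place of (3), the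
Poincaré clause of the product first test from `PoincareOfDecay` + the `decay` field, D3COEFF and TAIL in their v3 forms
(`γ₀` rational, `o₀ = orbitOf γ₀`).  Proof = v2's, through `twoVector_hit_L1'`. -/
theorem wall_of_L1_data' (hc : Continuous R.chi) (hu : ∀ a, ‖R.chi a‖ = 1)
    (hc' : Continuous R.chi') (hunit' : ∀ t, ‖R.chi' t‖ = 1) (hA : IsAnisotropic W)
    (q : QuadData k) (g g' : Matrix (Fin 4) (Fin 4) k) (w₀ : InfinitePlace k)
    (eP eM eP' eM' : InfinitePlace k → ℤ)
    (hnorm : ∀ (w : InfinitePlace k) (κ : GA W), κ ∈ localTorusAt' W w →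
      ∀ j : Fin 2, ‖weightAt' W q w g g' j κ‖ = 1)
    (D : KTypeData W R q g g' eP eM eP' eM')
    {τ : ℕ → Set (GA W → ℂ)} {φ : ℕ → GA W → ℂ} {n : ℕ → ℕ}
    (hB : (Setting.ofAdelicData W R μ DG fdG compG compT compT').IsAdaptedONB τ φ n)
    (hτcl : ∀ m, IsClosedSub (Setting.ofAdelicData W R μ DG fdG compG compT compT') (τ m))
    (hspec : RtfSpectralL1' (Setting.ofAdelicData W R μ DG fdG compG compT compT'))
    (hgeo : RtfGeometricL1 (Setting.ofAdelicData W R μ DG fdG compG compT compT'))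
    (hPc : PoincareOfConv (Setting.ofAdelicData W R μ DG fdG compG compT compT'))
    (hPd : PoincareOfDecay W (Setting.ofAdelicData W R μ DG fdG compG compT compT'))
    (hcl : AdaptedClosedUnderL1 (Setting.ofAdelicData W R μ DG fdG compG compT compT') τ)
    (γ₀ : (Setting.ofAdelicData W R μ DG fdG compG compT compT').Gk)
    (νinf : Measure (torusInf W)) (νinf' : Measure (torusInf' W))
    (hD3 : D3CoeffData' W (Setting.ofAdelicData W R μ DG fdG compG compT compT') R q g g' w₀ eP eM eP' eM'
      (γ₀ : GA W) νinf νinf')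
    (htail : TailForArch' W R μ DG fdG compG compT compT' q g g' w₀ eP eM eP' eM' γ₀ νinf νinf') :
    ∃ V : Submodule ℂ (GA W → ℂ),
      IsAdmissibleS W (Setting.ofAdelicData W R μ DG fdG compG compT compT') q g g' w₀ eP eM eP' eM' V ∧
      ∃ K : Subgroup (GA W), IsCompactOpenIn W (finitePart W) K ∧
        (∃ f ∈ kTypeSpace' W q g g' eP' eM' K V,
          periodLin W R.μT' R.DT' R.chi' (restrictTo W (torusT' W) f) ≠ 0) ∧
        ∃ f ∈ kTypeSpace' W q g g' eP' eM' K V,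
          periodLin W R.μT R.DT R.chi (restrictTo W (torusT W) f) ≠ 0 := by
  set S := Setting.ofAdelicData W R μ DG fdG compG compT compT' with hS
  have hχ : S.IsCharacter R.chi := isCharacter_chi W R μ DG fdG compG compT compT' hc hu
  have hχ' : S.IsCharacter' R.chi' := isCharacter'_chi' W R μ DG fdG compG compT compT' hc' hunit'
  obtain ⟨finf, hfinf⟩ := hD3
  obtain ⟨ffin, f₂, hfam, N₀, hN₀⟩ := htail finf hfinf
  set N : ℕ := max N₀ 1 with hNdef
  have hN1 : N ≠ 0 := by
    have : 1 ≤ N := le_max_right _ _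
    omega
  have hT := hN₀ N (le_max_left _ _)
  set f₁ : GA W → ℂ := prodFn W finf (ffin N) with hf₁
  have h₁ : IsTestL1 S f₁ :=
    ⟨continuous_prodFn W hfinf.cont (hfam.fin N).cont, hfinf.integrable _ (hfam.fin N)⟩
  have hP₁ : PoincareSummable S f₁ := hPd finf (ffin N) hfinf.cont hfinf.decay (hfam.fin N)
  have h₂ : IsTestFn W (f₂ N) := hfam.test₂ N
  have h₂' : RTF.IsTest (f₂ N) := ⟨h₂.1, h₂.2⟩
  haveI := secondCountable_GA W
  haveI := sigmaCompact_GA W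
  haveI := locallyCompactSpace_GA W
  haveI : SFinite S.μ := inferInstanceAs (SFinite μ)
  have hJ : S.J R.chi R.chi' (S.conv f₁ (f₂ N)) ≠ 0 :=
    J_ne_zero_of_tailDominated S hgeo hχ hχ' (isTestL1_conv S h₁ h₂') (hPc f₁ (f₂ N) h₁ h₂') hT
  obtain ⟨j, hhit, hper', hper⟩ :=
    twoVector_hit_L1' W R μ DG fdG compG compT compT' hc hu hc' hunit' hB hspec hcl h₁ hP₁ h₂ hJ
  set K : Subgroup (GA W) := levelK W N with hKdef
  have hK : IsCompactOpenIn W (finitePart W) K := isCompactOpenIn_levelK W hN1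
  have hst₁ := hst₁_L1 W R μ DG fdG compG compT compT' q g g' eP' eM' K hnorm hB hcl h₁
    (fun w κ hκ y => cj_prodFn_equiv W q g g' eP' eM' hfinf.equiv (ffin N) w κ hκ y)
    (fun κ hκ y => cj_prodFn_levelInv W N (hfam.leftInv N) κ hκ y) j
  have hst₂ := hst₂_L1 W R μ DG fdG compG compT compT' q g g' eP' eM' K hnorm hB h₂
    (fun w κ hκ y => refl_equiv W q g g' eP' eM' (hfam.equiv₂ N) w κ hκ y)
    (fun κ hκ y => refl_levelInv W K (hfam.rightInv₂ N) κ hκ y) j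
  refine ⟨Submodule.span ℂ ((fun ψ : GA W → ℂ => fun x => conj (ψ x)) '' τ (n j)), ?_, K, hK,
    ⟨_, hst₂, hper'⟩, ⟨_, hst₁, hper⟩⟩
  exact isAdmissibleS_span_conj_of_periods W R μ DG fdG compG compT compT' hc hu hc' hunit' hA q g g' w₀ eP eM
    eP' eM' D hB (hτcl (n j)) (hfinf.pseudo _ (hfam.fin N)) (hfinf.pseudo' _ (hfam.fin N)) hhit
    (kTypeSpace'_le W q g g' eP' eM' K _ hst₁) hper (kTypeSpace'_le W q g g' eP' eM' K _ hst₂) hper'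

end LayerBV3

end Summit.Ventures.HodgeRepro.Tier4.Line4.L1Class

end
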